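import Summits.BirchSwinnertonDyer.BirchSwinnertonDyer.Theorems.AdditiveKolyvaginRoadManinFrameResidueProperRTameTwistFull57
import HarnessLib

/-!
# The `p ∈ {5, 7}` tame-twist lever at a `p`-OPTIMAL datum: Manin's `p`-part from F″ when only
# `k·Λ_E ⊆ c·Λ_f ⊆ Λ_E` with `p ∤ k` is known
# (route `EdixhovenFibreFiveSeven`, crux TDS57 stmt-BirchSwinnertonDyer-22227, `--supports`, helper)

Cell `pub/bsd-wall` (D-0145 line `route-BirchSwinnertonDyer-EdixhovenFibreFiveSeven`), seat `bsd-line-edix-p3`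
(prover). THEOREMS ONLY (no definition, no named fact, no `sorry`); route-free. CONDITIONAL on the cite-only
Literature fact F″ = `kato_neron_isIntegral_twistedSymbolSum_of_additive_five_le` (binder `hK`). Nothing is
closed and BSD is not proved by this file.

## What and why

The landed lever `ManinFrameResidueProperRTameTwist.not_dvd_c_of_tameTwist57` (seat bsd-wall-manin-p1, p579959)
gives `p ∤ c(D)` for a LATTICE-OPTIMAL datum `D` (`Λ_E = c·Λ_f`, i.e. at the `X₀(N)`-optimal curve) of a
globally minimal `W` additive at `p ∈ {5, 7}` with `E[p]` irreducible and `W(ℚ_p)[p] = 0`, GRANTED F″. Its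
proof uses optimality only to compare the imaginary period `|Ω⁻(W)|` with `Ω⁻_f`: `ord_p(Ω⁻_f/|Ω⁻(W)|) =
−ord_p c`. That comparison survives when optimality is weakened to **`p`-optimality** — `k·Λ_E ⊆ c·Λ_f` for
some integer `k` prime to `p` (the inclusion `c·Λ_f ⊆ Λ_E` is part of every datum):

* `exists_int_mul_imaginaryPeriodRat_eq_of_pOptimal` — `c·Ω⁻_f = m·|Ω⁻(W)|` with `p ∤ m` (`jm = 2k` for the
  integer `j` with `k·|Ω⁻(W)| = c·j·Ω⁻_f/2`; `p` odd);
* **`not_dvd_c_of_tameTwist57_of_pOptimal`** — the lever at a `p`-optimal datum: F″ ∧ `p ∈ {5,7}` ∧ `Addv` ∧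
  `Irr` ∧ `W(ℚ_p)[p] = 0` ∧ `p² ∣ N` ∧ `a_ℓ = ±1` for `ℓ ∥ N` ⟹ `p ∤ c(D)` (the proof of
  `not_dvd_c_of_tameTwist57` verbatim with `ϖ = m/c`);
* `exists_pOptimal_datum_of_isIsogenous_optimal` — WHY `p`-optimal data are available where optimal ones are
  not: if `A ∼ V` over `ℚ` (both globally minimal, `E[p]` irreducible) and `D_A` is a lattice-optimal datum of
  `A` at level `N`, then `V` carries a `p`-OPTIMAL datum at level `N` with the same newform — the two integral
  multipliers `k·Λ_A ⊆ Λ_V`, `k'·Λ_V ⊆ Λ_A` prime to `p` of `X11b.exists_int_mul_mem_lattice_not_dvd` (a cyclic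
  `ℚ`-isogeny on the irreducible locus has degree prime to `p`; Néron mapping property).

USE (sibling file `…TwistDegreeStepFiveSevenPeriodTwist`): in the Kosters–Pannekoek sub-residue of TDS57 the
lever must be applied at a curve WITHOUT `ℚ_p`-rational `p`-torsion; the unit-twisted model `Vχ` of the
optimal curve is such a curve (`UnitTwistTorsion`), but only its optimal ISOGENOUS partner is known to carry a
lattice-optimal datum — `Vχ` itself carries a `p`-optimal one, which is enough here.

References: [Kato2004Asterisque] (8.1.3) (p. 180), Thm. 9.7 (p. 189); [KimNakamura2020] Cor. 2.4;
[KostersPannekoek2017] Thm. 1; [Manin1972] Thm. 1.6; [EdixhovenManin1991] §1, Prop. 2; [CremonaAlgorithms1997]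
§2.8; [JetchevSkinnerWan2017] §7.4.1, Remark 43.
-/

set_option autoImplicit false
set_option linter.dupNamespace false

noncomputable section

open scoped Classical MatrixGroups

open WeierstrassCurve NumberField Literature.NumberTheory.EllipticCurves
  Literature.NumberTheory.EllipticCurves.ModularForms
  Literature.NumberTheory.EllipticCurves.Rank1Residual
  Literature.NumberTheory.DiophantineGeometry IsDedekindDomain Rat.HeightOneSpectrum
  Summit.BirchSwinnertonDyer.Rank1Residual Summit.BirchSwinnertonDyer.Rank1Residual.Additive
  Summit.BirchSwinnertonDyer.BirchSwinnertonDyer.Theorems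
  CongruenceSubgroup Complex

namespace Summit.BirchSwinnertonDyer.BirchSwinnertonDyer.Theorems.TameTwistLeverPOptimal

section Periods

variable {W : WeierstrassCurve ℚ} [W.IsElliptic] {N : ℕ} [NeZero N] {p : ℕ} [hp : Fact p.Prime]

/-- **The imaginary period against `Ω⁻_f` at a `p`-optimal datum**: if `k·Λ_E ⊆ c·Λ_f` with `p ∤ k`
(`p` odd), then `c·Ω⁻_f = m·|Ω⁻(W)|` for an integer `m` with `p ∤ m`. As in
`SkinnerUrban2014.exists_dvd_two_mul_imaginaryPeriodRat_eq_of_latticeEq`: `Ω⁻_f/2 = im w'` with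
`c w' ∈ Λ_E` gives `c Ω⁻_f = m|Ω⁻|` (`im Λ_E ⊆ ℤ·|Ω⁻|/2`), and `k·i|Ω⁻| = c w`, `im w = jΩ⁻_f/2` gives
`jm = 2k`. [cite: EdixhovenManin1991, Prop. 2 and §1] [cite: CremonaAlgorithms1997, §2.8 (p. 26)] -/
theorem exists_int_mul_imaginaryPeriodRat_eq_of_pOptimal (hp2 : p ≠ 2) (D : ModularParametrizationData W N)
    (hpopt : ∃ k : ℤ, ¬ (p : ℤ) ∣ k ∧
      ∀ z ∈ D.L.lattice, ∃ w ∈ periodLattice D.f, (k : ℂ) * z = D.c * w) :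
    ∃ m : ℤ, ¬ (p : ℤ) ∣ m ∧ (D.c : ℝ) * minusPeriod D.f = m * W.imaginaryPeriodRat := by
  have hpP : p.Prime := hp.out
  have hminus : 0 < minusPeriod D.f :=
    IsNewform0.minusPeriod_pos_holds D.isNewformOf.1 D.isNewformOf.coeffField_eq_bot
  have him : imagPeriods D.f = AddSubgroup.zmultiples (minusPeriod D.f / 2) :=
    SkinnerUrban2014.imagPeriods_eq_zmultiples_of_minusPeriod_pos D.f hminus
  set Ω₁ := W.imaginaryPeriodRat with hΩ₁
  have hpos : 0 < Ω₁ := W.imaginaryPeriodRat_pos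
  obtain ⟨k, hpk, hk⟩ := hpopt
  -- (i) `k · iΩ₁ = c w`, `w ∈ Λ_f`, `im w = j Ω⁻_f/2`
  obtain ⟨w, hw, hΩw⟩ := hk _ (SkinnerUrban2014.I_mul_imaginaryPeriodRat_mem D)
  have hwim : w.im ∈ imagPeriods D.f := by
    rw [imagPeriods, AddSubgroup.mem_map]
    exact ⟨w, hw, rfl⟩
  rw [him, AddSubgroup.mem_zmultiples_iff] at hwim
  obtain ⟨j, hj⟩ := hwim
  have h1 : (k : ℝ) * Ω₁ = D.c * w.im := by
    have := congrArg Complex.im hΩw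
    simpa using this
  -- (ii) `Ω⁻_f/2 = im w'`, `c w' ∈ Λ_E`, so `c Ω⁻_f = m Ω₁`
  have hmem : minusPeriod D.f / 2 ∈ imagPeriods D.f := by
    rw [him]
    exact AddSubgroup.mem_zmultiples _
  rw [imagPeriods, AddSubgroup.mem_map] at hmem
  obtain ⟨w', hw', hw'im⟩ := hmem
  have hw'im' : w'.im = minusPeriod D.f / 2 := by simpa using hw'im
  have hcw' : (D.c : ℂ) * w' ∈ D.L.lattice := D.smul_periodLattice_le w' hw'
  obtain ⟨m, hm⟩ := SkinnerUrban2014.exists_im_eq_int_mul_imaginaryPeriodRat_div_two D hcw'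
  have hmul : ((D.c : ℂ) * w').im = (D.c : ℝ) * w'.im := by
    simp [Complex.mul_im]
  have h2 : (D.c : ℝ) * minusPeriod D.f = m * Ω₁ := by
    rw [hmul, hw'im'] at hm
    linarith
  refine ⟨m, fun hpm ↦ ?_, h2⟩
  -- `j m = 2 k`
  have hjm : (j : ℝ) * m = 2 * k := by
    have e1 : (k : ℝ) * Ω₁ = D.c * (j * (minusPeriod D.f / 2)) := by rw [h1, ← hj, zsmul_eq_mul]
    have e2 : Ω₁ * (2 * k) = Ω₁ * (j * m) := by
      calc Ω₁ * (2 * k) = 2 * ((k : ℝ) * Ω₁) := by ring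
        _ = 2 * ((D.c : ℝ) * (j * (minusPeriod D.f / 2))) := by rw [e1]
        _ = j * ((D.c : ℝ) * minusPeriod D.f) := by ring
        _ = j * (m * Ω₁) := by rw [h2]
        _ = Ω₁ * (j * m) := by ring
    exact (mul_left_cancel₀ hpos.ne' e2).symm
  have hjm' : j * m = 2 * k := by exact_mod_cast hjm
  have hp2k : (p : ℤ) ∣ 2 * k := hjm' ▸ hpm.mul_left j
  rcases (Nat.prime_iff_prime_int.mp hpP).dvd_or_dvd hp2k with h | h
  · have : p ∣ 2 := by exact_mod_cast h
    exact hp2 ((Nat.prime_dvd_prime_iff_eq hpP Nat.prime_two).mp this)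
  · exact hpk h

/-- At a `p`-optimal datum (`p` odd): `ord_p(Ω⁻_f/|Ω⁻(W)|) = −ord_p c`, i.e. for the rational scalar `ϖ = m/c`
with `ϖ·|Ω⁻(W)| = Ω⁻_f`. [cite: EdixhovenManin1991, §1] [cite: Pal2012, p. 1514] -/
theorem exists_varpi_of_pOptimal (hp2 : p ≠ 2) (D : ModularParametrizationData W N)
    (hpopt : ∃ k : ℤ, ¬ (p : ℤ) ∣ k ∧
      ∀ z ∈ D.L.lattice, ∃ w ∈ periodLattice D.f, (k : ℂ) * z = D.c * w) :
    ∃ ϖ : ℚ, (ϖ : ℝ) * W.imaginaryPeriodRat = minusPeriod D.f ∧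
      padicValRat p ϖ = -padicValRat p (D.c : ℚ) := by
  have hc0 : D.c ≠ 0 := D.maninConstant_ne_zero_holds
  obtain ⟨m, hpm, hm⟩ := exists_int_mul_imaginaryPeriodRat_eq_of_pOptimal hp2 D hpopt
  have hm0 : m ≠ 0 := by rintro rfl; exact hpm (dvd_zero _)
  refine ⟨(m : ℚ) / (D.c : ℚ), ?_, ?_⟩
  · have hc : (D.c : ℝ) ≠ 0 := by exact_mod_cast hc0
    push_cast
    rw [div_mul_eq_mul_div, div_eq_iff hc, mul_comm (minusPeriod D.f), ← hm]
  · rw [padicValRat.div (by exact_mod_cast hm0) (by exact_mod_cast hc0), padicValRat.of_int,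
      padicValInt.eq_zero_of_not_dvd hpm]
    simp

end Periods

/-! ### §2 The lever at a `p`-optimal datum -/

section Lever

variable {p : ℕ} [hp : Fact p.Prime]

/-- **Manin's `p`-part at a `p`-OPTIMAL datum, `p ∈ {5, 7}`, off the Kosters–Pannekoek exception.** Let `W/ℚ`
be globally minimal, additive at `p ∈ {5, 7}` with `E[p]` irreducible and `W(ℚ_p)[p] = 0`, `D` a datum at a
level `N` with `p² ∣ N`, `a_ℓ(W) = ±1` for `ℓ ∥ N`, which is `p`-OPTIMAL: `k·Λ_E ⊆ c·Λ_f` for some integer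
`k` prime to `p`. GRANTED the `p ≥ 5` Kato–Kosters–Pannekoek fact F″: `p ∤ c`. Proof =
`ManinFrameResidueProperRTameTwist.not_dvd_c_of_tameTwist57` (manin-p1 g4) verbatim, the period scalar `ϖ`
now taken from `exists_varpi_of_pOptimal`. CONDITIONAL on F″; BSD is not proved by this.
[cite: Kato2004Asterisque, (8.1.3) (p. 180), Thm. 9.7 (p. 189)] [cite: KimNakamura2020, Cor. 2.4]
[cite: KostersPannekoek2017, Thm. 1 and Cor. 2] [cite: Manin1972, Thm. 1.6] -/
theorem not_dvd_c_of_tameTwist57_of_pOptimal (hK : kato_neron_isIntegral_twistedSymbolSum_of_additive_five_le)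
    (hp57 : p = 5 ∨ p = 7)
    (W : WeierstrassCurve ℚ) [W.IsElliptic] [W.IsGloballyMinimal] {N : ℕ} [NeZero N]
    (D : ModularParametrizationData W N)
    (hpopt : ∃ k : ℤ, ¬ (p : ℤ) ∣ k ∧
      ∀ z ∈ D.L.lattice, ∃ w ∈ periodLattice D.f, (k : ℂ) * z = D.c * w)
    (hPT : ∀ P : (W.baseChange ℚ_[p]).toAffine.Point, p • P = 0 → P = 0)
    (hadd : Addv W p) (hirr : Irr W p) (hpN : p ^ 2 ∣ N)
    (ha : ∀ ℓ ∈ N.primeFactors, ¬ ℓ ^ 2 ∣ N → W.LFunction ℓ = 1 ∨ W.LFunction ℓ = -1) :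
    ¬ (p : ℤ) ∣ D.c := by
  have hpP : p.Prime := hp.out
  have hp2 : p ≠ 2 := by rcases hp57 with rfl | rfl <;> norm_num
  have hc0 : D.c ≠ 0 := D.maninConstant_ne_zero_holds
  -- the period scalar `ϖ = m/c`, `ord_p ϖ = −ord_p c`
  obtain ⟨ϖ, hϖ, hvϖ⟩ := exists_varpi_of_pOptimal hp2 D hpopt
  have hΩf : 0 < minusPeriod D.f :=
    IsNewform0.minusPeriod_pos_holds D.isNewformOf.1 D.isNewformOf.coeffField_eq_bot
  have hΩ : 0 < W.imaginaryPeriodRat := W.imaginaryPeriodRat_pos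
  -- `Ω⁻_f/2 = Im {∞, γ∞}_f` for some `γ`
  have hmem : minusPeriod D.f / 2 ∈ imagPeriods D.f := by
    rw [SkinnerUrban2014.imagPeriods_eq_zmultiples_of_minusPeriod_pos D.f hΩf]
    exact AddSubgroup.mem_zmultiples _
  obtain ⟨z, hz, hzim⟩ := AddSubgroup.mem_map.mp hmem
  have hz' : z ∈ (periodLattice D.f : Set ℂ) := hz
  rw [coe_periodLattice_eq_range] at hz'
  obtain ⟨γ, hγ⟩ := hz'
  have hP := ManinFrameResidueProperRTameTwist.pint_im_cuspSymbol57 hK hp57 (Or.inr hPT) hadd hirr D.f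
    D.isNewformOf hpN ha hϖ γ
  rw [hγ] at hP
  have hzim' : z.im = minusPeriod D.f / 2 := hzim
  -- `Im z / Ω = ϖ/2`
  have hq : (((z.im : ℝ) : ℂ) / (W.imaginaryPeriodRat : ℂ)) = ((ϖ / 2 : ℚ) : ℂ) := by
    rw [hzim', ← hϖ]
    have hΩ0 : (W.imaginaryPeriodRat : ℂ) ≠ 0 := by exact_mod_cast hΩ.ne'
    push_cast
    field_simp
  rw [hq] at hP
  have hval := ManinFrameResidueProperRTameTwist.padicValRat_nonneg_of_pint hP
  have hϖ2 : padicValRat p (ϖ / 2) = padicValRat p ϖ := by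
    have hϖ0 : ϖ ≠ 0 := by
      rintro h; rw [h, Rat.cast_zero, zero_mul] at hϖ; exact hΩf.ne' hϖ.symm
    rw [padicValRat.div hϖ0 two_ne_zero, show (2 : ℚ) = ((2 : ℕ) : ℚ) by norm_num, padicValRat.of_nat,
      padicValNat.eq_zero_of_not_dvd (fun h ↦ hp2 ((Nat.prime_dvd_prime_iff_eq hpP Nat.prime_two).mp h))]
    simp
  rw [hϖ2, hvϖ] at hval
  exact ManinFrameResidueProperRTameTwist.not_dvd_of_padicValRat_intCast_le_zero hc0 (by linarith)

end Lever

/-! ### §3 `p`-optimal data along the isogeny class -/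

section Transport

/-- A lattice-optimal datum is `p`-optimal (`k = 1`). [folklore] -/
theorem pOptimal_of_optimal {W : WeierstrassCurve ℚ} {N : ℕ} [NeZero N] {p : ℕ}
    (D : ModularParametrizationData W N) (hopt : ∀ z ∈ D.L.lattice, ∃ w ∈ periodLattice D.f, z = D.c * w)
    (hp : p.Prime) :
    ∃ k : ℤ, ¬ (p : ℤ) ∣ k ∧ ∀ z ∈ D.L.lattice, ∃ w ∈ periodLattice D.f, (k : ℂ) * z = D.c * w := by
  refine ⟨1, fun h ↦ hp.ne_one (by exact_mod_cast Int.eq_one_of_dvd_one (by norm_num) h), fun z hz ↦ ?_⟩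
  obtain ⟨w, hw, hzw⟩ := hopt z hz
  exact ⟨w, hw, by rw [Int.cast_one, one_mul, hzw]⟩

/-- **A `p`-optimal datum on every globally minimal member with `E[p]` irreducible of the class of an
optimal curve.** If `A ∼ V` over `ℚ` (`A`, `V` globally minimal, `V[p]` irreducible) and `D_A` is a
LATTICE-OPTIMAL datum of `A` at level `N` (`Λ_A = c_A·Λ_g`), then `V` carries a datum `D` at level `N` with
the same newform, `D.f = D_A.f`, which is `p`-OPTIMAL: `k·Λ_V ⊆ c(D)·Λ_g` for some integer `k` prime to `p`.
Construction: integral multipliers `k₁·Λ_A ⊆ Λ_V` and `k₂·Λ_V ⊆ Λ_A` prime to `p`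
(`X11b.exists_int_mul_mem_lattice_not_dvd` in both directions, Néron mapping property
`integral_neronScaling_of_isGloballyMinimal_holds`); `D = (g, Λ_V, k₁ c_A)`
(`ModularParametrizationData.exists_of_isNewformOf`), and `(k₁k₂)·Λ_V ⊆ k₁·Λ_A = k₁c_A·Λ_g`.
[cite: JetchevSkinnerWan2017, §7.4.1 (p. 30) and Remark 43] [cite: SilvermanATAEC1994, IV.5.1 with IV.6.1] -/
theorem exists_pOptimal_datum_of_isIsogenous_optimal
    (V : WeierstrassCurve ℚ) [V.IsElliptic] [V.IsGloballyMinimal] {p : ℕ} (hp : p.Prime)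
    (hirr : V.HasIrreducibleModPGaloisRep p)
    {A : WeierstrassCurve ℚ} [A.IsElliptic] [A.IsGloballyMinimal] (hiso : IsIsogenous V A)
    {N : ℕ} [NeZero N] (DA : ModularParametrizationData A N)
    (hopt : ∀ z ∈ DA.L.lattice, ∃ w ∈ periodLattice DA.f, z = DA.c * w) :
    ∃ D : ModularParametrizationData V N, D.f = DA.f ∧
      ∃ k : ℤ, ¬ (p : ℤ) ∣ k ∧ ∀ z ∈ D.L.lattice, ∃ w ∈ periodLattice D.f, (k : ℂ) * z = D.c * w := by
  haveI : (V.baseChange ℂ).IsElliptic := by rw [WeierstrassCurve.baseChange]; infer_instance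
  -- the newform of `A` is a newform of `V`
  have hfV : IsNewformOf V DA.f := DA.isNewformOf.of_isIsogenous hiso
  haveI : Fact p.Prime := ⟨hp⟩
  have hirrA : A.HasIrreducibleModPGaloisRep p := (X12.irr_iff_of_isIsogenous hiso p).mp hirr
  -- a Néron lattice of `V` and the two integral multipliers prime to `p`
  obtain ⟨LV, hLV⟩ := exists_isNeronLatticeOf_holds (V.baseChange ℂ)
  obtain ⟨k₁, hk₁0, hpk₁, hk₁⟩ :=
    X11b.exists_int_mul_mem_lattice_not_dvd integral_neronScaling_of_isGloballyMinimal_holds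
      hiso.symm_of_charZero DA.isNeronLattice hLV hp hirr
  obtain ⟨k₂, -, hpk₂, hk₂⟩ :=
    X11b.exists_int_mul_mem_lattice_not_dvd integral_neronScaling_of_isGloballyMinimal_holds
      hiso hLV DA.isNeronLattice hp hirrA
  -- the datum `(g, Λ_V, k₁ c_A)` of `V`
  have hm0 : k₁ * DA.c ≠ 0 := mul_ne_zero hk₁0 DA.maninConstant_ne_zero_holds
  have hle : ∀ z ∈ periodLattice DA.f, ((k₁ * DA.c : ℤ) : ℂ) * z ∈ LV.lattice := fun z hz ↦ by
    have h2 := hk₁ _ (DA.smul_periodLattice_le z hz)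
    rwa [← mul_assoc, ← Int.cast_mul] at h2
  obtain ⟨D, hDf, hDL, hDc⟩ := ModularParametrizationData.exists_of_isNewformOf hfV hLV hm0 hle
  refine ⟨D, hDf, k₁ * k₂, ?_, fun z hz ↦ ?_⟩
  · intro h
    rcases (Nat.prime_iff_prime_int.mp hp).dvd_or_dvd h with h | h
    · exact hpk₁ h
    · exact hpk₂ h
  · rw [hDL] at hz
    obtain ⟨w, hw, hzw⟩ := hopt _ (hk₂ z hz)
    refine ⟨w, by rw [hDf]; exact hw, ?_⟩
    rw [hDc, Int.cast_mul, Int.cast_mul, mul_assoc, hzw, ← mul_assoc]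

end Transport

end Summit.BirchSwinnertonDyer.BirchSwinnertonDyer.Theorems.TameTwistLeverPOptimal

end
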